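import Summits.AtomisticToContinuum.Crystallization.Theorems.FrustratedLawDichotomySignedLedgerHardCoreClass

/-!
# FrustratedLawDichotomy · crux `AperiodicFrustratedLawGap` (stmt-AtomisticToContinuum-27623) — SATURATED REGIMES: clause-admissible versions and dispatch
# (decomp-a2c hand-2 g45, STRUCTURAL share #53: DEF-FREE companion of `…SignedLedgerErgodic` §2 / `…SignedLedgerHardCoreClass`)

A SATURATED regime is «every re-rooting at an atom lies in `C`» (or «some re-rooting at an atom lies in `C`») for a measurable set `C` of
measures — e.g. «everywhere locally lattice-like within `τ₀`», «some atom carries a hole boundary», with `C` a ROOT-LOCAL measurable condition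
(ball counts about the root).  Such regimes are what the E′ list is made of, but as sets of measures they are neither obviously measurable
(quantification over atoms) nor invariant for EVERY measure (the clause of `S_aperiodicErgodicGap` asks both).  Here, with NO new definitions:

* §1 the kernel-lintegral TEST: with the tree's truncated identity kernel `κ` (`…FiniteClusterGap.exists_kernel_eq_count_restrict`: s-finite,
  `κ (count|S) = count|S` on separated `S`) the functional `μ ↦ ∫⁻ y, g ((κ μ).map (· − y)) ∂(κ μ)` is Giry-measurable for measurable `g`
  (`measurable_lintegral_reroot_kernel`); on separated counting measures it is `∫⁻ y, g (θ_y μ) ∂μ`, which vanishes iff `g (θ_y μ) = 0` at every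
  atom (`lintegral_reroot_eq_zero_iff`) and is INVARIANT under re-rooting at an atom (`lintegral_reroot_map_sub`, a change of variables along the
  measurable equivalence `z ↦ z − p`, no measurability of the integrand needed);
* §2 ★ `exists_version_forall_reroot` / `exists_version_exists_reroot`: for measurable `C` there is a set `A` of measures which is MEASURABLE,
  RE-ROOTING INVARIANT FOR EVERY MEASURE WITH AN ATOM (the clause's hypothesis verbatim), and AGREES on rooted `δ`-hard-core configurations with
  «∀ atoms `p`, `θ_p μ ∈ C`» (resp. «∃ atom `p`, `θ_p μ ∈ C`») — namely the ball-condition class of `…HardCoreClass` cut by the §1 test;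
* §3 ★ `exists_ae_forall_reroot_of_ergodic_cover` and ★ `nonempty_lawLedger_of_ergodic_saturatedRegimes`: DISPATCH over countably many saturated
  regimes for a law a.s. rooted `δ`-hard-core satisfying the clause — the ONLY side condition left to the consumer is `MeasurableSet (C i)`
  (plus the a.e. cover and the per-regime ledgers).

Tags: [folklore: point-process measurability / ergodicity].
-/

noncomputable section

namespace Summit.AtomisticToContinuum.Crystallization.Theorems.FrustratedLawDichotomySignedLedgerSaturated

open MeasureTheory Metric Set Filter TopologicalSpace ProbabilityTheory
open scoped ENNReal Topology BigOperators
open Literature.Probability.Process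
open Summit.AtomisticToContinuum.Crystallization.Theorems.ChargedEnergyGapNegative (E3)
open Summit.AtomisticToContinuum.Crystallization.Theorems.FrustratedLawDichotomySignedLedger (LawLedger)
open Summit.AtomisticToContinuum.Crystallization.Theorems.FrustratedLawDichotomySignedLedgerErgodic (exists_ae_mem_of_ergodic_cover)
open Summit.AtomisticToContinuum.Crystallization.Theorems.FrustratedLawDichotomySignedLedgerHardCoreClass
  (measurableSet_setOf_ballCondition ballCondition_of_isRootedHardCore ballCondition_map_sub_iff
    exists_eq_count_restrict_of_ballCondition)
open Summit.AtomisticToContinuum.Crystallization.Theorems.FrustratedLawDichotomyFiniteClusterGap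
  (ae_mem_of_sep exists_kernel_eq_count_restrict measurable_kernel_map_sub)

variable {δ : ℝ}

/-! ## §1. The kernel-lintegral test -/

/-- For an s-finite kernel `κ` on measures and a measurable `g ≥ 0` on measures, `μ ↦ ∫⁻ y, g ((κ μ).map (· − y)) ∂(κ μ)` is Giry-measurable.
[folklore] -/
theorem measurable_lintegral_reroot_kernel (κ : Kernel (Measure E3) E3) [IsSFiniteKernel κ] {g : Measure E3 → ℝ≥0∞}
    (hg : Measurable g) : Measurable fun μ : Measure E3 => ∫⁻ y, g ((κ μ).map fun z : E3 => z - y) ∂(κ μ) :=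
  Measurable.lintegral_kernel_prod_right (κ := κ)
    (f := fun (μ : Measure E3) (y : E3) => g ((κ μ).map fun z : E3 => z - y)) (hg.comp (measurable_kernel_map_sub κ))

/-- **Change of root = change of variables.**  For EVERY measure `μ`, every `p` and every `g` (measurable or not):
`∫⁻ y, g (θ_y (θ_p μ)) ∂(θ_p μ) = ∫⁻ w, g (θ_w μ) ∂μ` (translation is a measurable equivalence; `θ_{w − p} θ_p = θ_w`). [folklore] -/
theorem lintegral_reroot_map_sub (μ : Measure E3) (p : E3) (g : Measure E3 → ℝ≥0∞) :
    ∫⁻ y, g ((μ.map fun z : E3 => z - p).map fun z : E3 => z - y) ∂(μ.map fun z : E3 => z - p) =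
      ∫⁻ w, g (μ.map fun z : E3 => z - w) ∂μ := by
  have he : (fun z : E3 => z - p) = ⇑(MeasurableEquiv.subRight p) := rfl
  have hθ : ∀ w : E3, ((μ.map fun z : E3 => z - p).map fun z : E3 => z - (w - p)) = μ.map fun z : E3 => z - w := by
    intro w
    rw [Measure.map_map (measurable_sub_const (w - p)) (measurable_sub_const p)]
    congr 1
    funext z
    simp only [Function.comp_apply, sub_sub, add_sub_cancel]
  calc ∫⁻ y, g ((μ.map fun z : E3 => z - p).map fun z : E3 => z - y) ∂(μ.map fun z : E3 => z - p)
      = ∫⁻ w, g ((μ.map fun z : E3 => z - p).map fun z : E3 => z - (w - p)) ∂μ := by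
        rw [he, lintegral_map_equiv]
        rfl
    _ = ∫⁻ w, g (μ.map fun z : E3 => z - w) ∂μ := by
        refine lintegral_congr fun w => ?_
        rw [hθ w]

/-- **The test on a separated counting measure.**  For `μ = count|S` with `S` `δ`-separated (`δ > 0`) and any `g ≥ 0`:
`∫⁻ y, g (θ_y μ) ∂μ = 0` iff `g (θ_y μ) = 0` at every atom `y ∈ S`. [folklore] -/
theorem lintegral_reroot_eq_zero_iff (hδ : 0 < δ) {S : Set E3} (hsep : ∀ x ∈ S, ∀ y ∈ S, x ≠ y → δ ≤ dist x y)
    (g : Measure E3 → ℝ≥0∞) :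
    ∫⁻ y, g (((Measure.count : Measure E3).restrict S).map fun z : E3 => z - y) ∂((Measure.count : Measure E3).restrict S) = 0 ↔
      ∀ y ∈ S, g (((Measure.count : Measure E3).restrict S).map fun z : E3 => z - y) = 0 := by
  set μ : Measure E3 := (Measure.count : Measure E3).restrict S with hμ
  constructor
  · intro h y hy
    have hy1 : μ {y} = 1 := by
      rw [hμ, Measure.restrict_apply (measurableSet_singleton y), inter_eq_left.2 (singleton_subset_iff.2 hy),
        Measure.count_singleton]
    have hle : g (μ.map fun z : E3 => z - y) * μ {y} ≤ ∫⁻ w, g (μ.map fun z : E3 => z - w) ∂μ := by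
      have hsing := lintegral_singleton (μ := μ) (fun w => g (μ.map fun z : E3 => z - w)) y
      rw [← hsing]
      exact lintegral_mono' Measure.restrict_le_self le_rfl
    rw [h, hy1, mul_one] at hle
    exact le_antisymm hle zero_le
  · intro h
    have hS : ∀ᵐ y ∂μ, y ∈ S := by rw [hμ]; exact ae_mem_of_sep hδ hsep
    have hae : (fun y => g (μ.map fun z : E3 => z - y)) =ᵐ[μ] fun _ => 0 := by
      filter_upwards [hS] with y hy using h y hy
    rw [lintegral_congr_ae hae, lintegral_zero]

/-! ## §2. Clause-admissible versions of saturated regimes -/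

/-- **VERSION LEMMA («every re-rooting in `C`»).**  For `δ > 0` and a measurable set `C` of measures there is a set `A` of measures which is
Giry-measurable, re-rooting invariant FOR EVERY MEASURE WITH AN ATOM (the hypothesis of the residual's ergodicity clause, verbatim), and which on
rooted `δ`-hard-core configurations says exactly «`θ_p μ ∈ C` for every atom `p`» (the ball-condition class cut by the kernel-lintegral test of
`𝟙_{Cᶜ}`). [folklore] -/
theorem exists_version_forall_reroot (hδ : 0 < δ) {C : Set (Measure E3)} (hC : MeasurableSet C) :
    ∃ A : Set (Measure E3), MeasurableSet A ∧
      (∀ μ : Measure E3, ∀ p : E3, μ {p} ≠ 0 → (μ ∈ A ↔ Measure.map (fun z : E3 => z - p) μ ∈ A)) ∧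
      ∀ μ : Measure E3, IsRootedHardCore δ μ →
        (μ ∈ A ↔ ∀ p : E3, μ {p} ≠ 0 → Measure.map (fun z : E3 => z - p) μ ∈ C) := by
  obtain ⟨κ, hκs, hκ⟩ := exists_kernel_eq_count_restrict hδ
  haveI := hκs
  set g : Measure E3 → ℝ≥0∞ := Cᶜ.indicator 1 with hg
  have hgm : Measurable g := measurable_one.indicator hC.compl
  have hg0 : ∀ ν : Measure E3, g ν = 0 ↔ ν ∈ C := by
    intro ν
    rw [hg, indicator_apply_eq_zero]
    simp only [mem_compl_iff, Pi.one_apply, one_ne_zero, imp_false, not_not]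
  set Ψ : Measure E3 → ℝ≥0∞ := fun μ => ∫⁻ y, g ((κ μ).map fun z : E3 => z - y) ∂(κ μ) with hΨ
  have hΨm : Measurable Ψ := measurable_lintegral_reroot_kernel κ hgm
  set B : Set (Measure E3) := {μ : Measure E3 | ∀ n : ℕ, ∀ q : ℚ, (q : ℝ) < δ / 2 → μ (ball (denseSeq E3 n) q) = 0 ∨ μ (ball (denseSeq E3 n) q) = 1} with hB
  refine ⟨B ∩ Ψ ⁻¹' {0}, (measurableSet_setOf_ballCondition δ).inter (hΨm (measurableSet_singleton 0)), ?_, ?_⟩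
  · -- invariance for every measure with an atom
    intro μ p hp
    by_cases hμ : μ ∈ B
    · -- a separated counting measure: κ is the identity on it and on its re-rooting, and the test is a change of variables
      have hμ' : Measure.map (fun z : E3 => z - p) μ ∈ B := by
        rw [hB, mem_setOf_eq, ballCondition_map_sub_iff δ]
        exact hμ
      obtain ⟨S, hsep, hS⟩ := exists_eq_count_restrict_of_ballCondition hδ (show μ ∈ B from hμ)
      have hκμ : κ μ = μ := by rw [hS]; exact hκ S hsep
      have hsep' : ∀ x ∈ (fun z : E3 => z - p) '' S, ∀ y ∈ (fun z : E3 => z - p) '' S, x ≠ y → δ ≤ dist x y := by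
        rintro _ ⟨x, hx, rfl⟩ _ ⟨x', hx', rfl⟩ hne
        rw [dist_sub_right]
        exact hsep x hx x' hx' fun h => hne (by rw [h])
      have hκμ' : κ (Measure.map (fun z : E3 => z - p) μ) = Measure.map (fun z : E3 => z - p) μ := by
        rw [hS, map_sub_count_restrict S p]
        exact hκ _ hsep'
      have hΨeq : Ψ (Measure.map (fun z : E3 => z - p) μ) = Ψ μ := by
        simp only [hΨ]
        rw [hκμ, hκμ', lintegral_reroot_map_sub]
      simp only [mem_inter_iff, mem_preimage, mem_singleton_iff, hΨeq]
      exact ⟨fun h => ⟨hμ', h.2⟩, fun h => ⟨hμ, h.2⟩⟩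
    · have hμ' : Measure.map (fun z : E3 => z - p) μ ∉ B := by
        rw [hB, mem_setOf_eq, ballCondition_map_sub_iff δ]
        exact hμ
      simp only [mem_inter_iff]
      exact ⟨fun h => absurd h.1 hμ, fun h => absurd h.1 hμ'⟩
  · -- agreement on rooted hard-core configurations
    intro μ hμ
    have hBμ : μ ∈ B := ballCondition_of_isRootedHardCore hμ
    obtain ⟨S, h0S, hsep, hS⟩ := hμ
    have hκμ : κ μ = μ := by rw [hS]; exact hκ S hsep
    simp only [mem_inter_iff, mem_preimage, mem_singleton_iff, hΨ, hκμ]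
    rw [hS, lintegral_reroot_eq_zero_iff hδ hsep g]
    constructor
    · rintro ⟨-, h⟩ p hp
      have hpS : p ∈ S := (count_restrict_singleton_ne_zero_iff S p).mp hp
      exact (hg0 _).mp (h p hpS)
    · intro h
      refine ⟨by rw [← hS]; exact hBμ, fun y hy => (hg0 _).mpr (h y ((count_restrict_singleton_ne_zero_iff S y).mpr hy))⟩

/-- **VERSION LEMMA («some re-rooting in `C`»).**  The same for the regime «`θ_p μ ∈ C` for SOME atom `p`» (test `𝟙_C ≠ 0`). [folklore] -/
theorem exists_version_exists_reroot (hδ : 0 < δ) {C : Set (Measure E3)} (hC : MeasurableSet C) :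
    ∃ A : Set (Measure E3), MeasurableSet A ∧
      (∀ μ : Measure E3, ∀ p : E3, μ {p} ≠ 0 → (μ ∈ A ↔ Measure.map (fun z : E3 => z - p) μ ∈ A)) ∧
      ∀ μ : Measure E3, IsRootedHardCore δ μ →
        (μ ∈ A ↔ ∃ p : E3, μ {p} ≠ 0 ∧ Measure.map (fun z : E3 => z - p) μ ∈ C) := by
  obtain ⟨A, hAm, hAinv, hA⟩ := exists_version_forall_reroot hδ hC.compl
  refine ⟨Aᶜ, hAm.compl, fun μ p hp => ?_, fun μ hμ => ?_⟩
  · rw [mem_compl_iff, mem_compl_iff, hAinv μ p hp]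
  · rw [mem_compl_iff, hA μ hμ]
    simp only [not_forall, mem_compl_iff, not_not, exists_prop]

/-! ## §3. Dispatch over saturated regimes -/

/-- **ONE SATURATED REGIME CARRIES AN ERGODIC HARD-CORE LAW.**  A probability law a.s. rooted `δ`-hard-core (`δ > 0`) satisfying the residual's
ergodicity clause (verbatim), and countably many MEASURABLE sets `C i` of measures such that almost every configuration has, for some `i`, all its
re-rootings at atoms in `C i`: then for ONE `i` almost every configuration has all its re-rootings in `C i`.  No invariance or measurability of the
regimes themselves is asked (§2 supplies clause-admissible versions). [folklore: ergodicity] -/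
theorem exists_ae_forall_reroot_of_ergodic_cover (hδ : 0 < δ) {P : Measure (Measure E3)} [IsProbabilityMeasure P]
    (hcore : ∀ᵐ μ ∂P, IsRootedHardCore δ μ) {ι : Type*} [Countable ι] (C : ι → Set (Measure E3))
    (hC : ∀ i, MeasurableSet (C i))
    (herg : ∀ A : Set (MeasureTheory.Measure (EuclideanSpace ℝ (Fin 3))), MeasurableSet A → (∀ μ : MeasureTheory.Measure (EuclideanSpace ℝ (Fin 3)), ∀ p : EuclideanSpace ℝ (Fin 3), μ {p} ≠ 0 → (μ ∈ A ↔ MeasureTheory.Measure.map (fun z : EuclideanSpace ℝ (Fin 3) => z - p) μ ∈ A)) → P A = 0 ∨ P Aᶜ = 0)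
    (hcover : ∀ᵐ μ ∂P, ∃ i, ∀ p : E3, μ {p} ≠ 0 → Measure.map (fun z : E3 => z - p) μ ∈ C i) :
    ∃ i, ∀ᵐ μ ∂P, ∀ p : E3, μ {p} ≠ 0 → Measure.map (fun z : E3 => z - p) μ ∈ C i := by
  choose A hAm hAinv hA using fun i => exists_version_forall_reroot hδ (hC i)
  have hcover' : ∀ᵐ μ ∂P, ∃ i, μ ∈ A i := by
    filter_upwards [hcore, hcover] with μ hμ hc
    obtain ⟨i, hi⟩ := hc
    exact ⟨i, (hA i μ hμ).mpr hi⟩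
  obtain ⟨i, hi⟩ := exists_ae_mem_of_ergodic_cover A hAm hAinv herg hcover'
  refine ⟨i, ?_⟩
  filter_upwards [hcore, hi] with μ hμ hμA
  exact (hA i μ hμ).mp hμA

/-- The same dispatch for «some re-rooting in `C i`» regimes. [folklore: ergodicity] -/
theorem exists_ae_exists_reroot_of_ergodic_cover (hδ : 0 < δ) {P : Measure (Measure E3)} [IsProbabilityMeasure P]
    (hcore : ∀ᵐ μ ∂P, IsRootedHardCore δ μ) {ι : Type*} [Countable ι] (C : ι → Set (Measure E3))
    (hC : ∀ i, MeasurableSet (C i))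
    (herg : ∀ A : Set (MeasureTheory.Measure (EuclideanSpace ℝ (Fin 3))), MeasurableSet A → (∀ μ : MeasureTheory.Measure (EuclideanSpace ℝ (Fin 3)), ∀ p : EuclideanSpace ℝ (Fin 3), μ {p} ≠ 0 → (μ ∈ A ↔ MeasureTheory.Measure.map (fun z : EuclideanSpace ℝ (Fin 3) => z - p) μ ∈ A)) → P A = 0 ∨ P Aᶜ = 0)
    (hcover : ∀ᵐ μ ∂P, ∃ i, ∃ p : E3, μ {p} ≠ 0 ∧ Measure.map (fun z : E3 => z - p) μ ∈ C i) :
    ∃ i, ∀ᵐ μ ∂P, ∃ p : E3, μ {p} ≠ 0 ∧ Measure.map (fun z : E3 => z - p) μ ∈ C i := by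
  choose A hAm hAinv hA using fun i => exists_version_exists_reroot hδ (hC i)
  have hcover' : ∀ᵐ μ ∂P, ∃ i, μ ∈ A i := by
    filter_upwards [hcore, hcover] with μ hμ hc
    obtain ⟨i, hi⟩ := hc
    exact ⟨i, (hA i μ hμ).mpr hi⟩
  obtain ⟨i, hi⟩ := exists_ae_mem_of_ergodic_cover A hAm hAinv herg hcover'
  refine ⟨i, ?_⟩
  filter_upwards [hcore, hi] with μ hμ hμA
  exact (hA i μ hμ).mp hμA

/-- **LEDGER BY SATURATED REGIMES.**  Under the ergodicity clause, for a law a.s. rooted `δ`-hard-core: a ledger at level `c` proved separately on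
each of countably many saturated regimes «every re-rooting at an atom lies in `C i`» (`C i` measurable, regimes covering a.e.; each piece only for
laws a.s. in its regime) is a ledger at level `c`. [folklore: ergodicity] -/
theorem nonempty_lawLedger_of_ergodic_saturatedRegimes (hδ : 0 < δ) {P : Measure (Measure E3)} [IsProbabilityMeasure P] {c : ℝ}
    (hcore : ∀ᵐ μ ∂P, IsRootedHardCore δ μ) {ι : Type*} [Countable ι] (C : ι → Set (Measure E3))
    (hC : ∀ i, MeasurableSet (C i))
    (herg : ∀ A : Set (MeasureTheory.Measure (EuclideanSpace ℝ (Fin 3))), MeasurableSet A → (∀ μ : MeasureTheory.Measure (EuclideanSpace ℝ (Fin 3)), ∀ p : EuclideanSpace ℝ (Fin 3), μ {p} ≠ 0 → (μ ∈ A ↔ MeasureTheory.Measure.map (fun z : EuclideanSpace ℝ (Fin 3) => z - p) μ ∈ A)) → P A = 0 ∨ P Aᶜ = 0)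
    (hcover : ∀ᵐ μ ∂P, ∃ i, ∀ p : E3, μ {p} ≠ 0 → Measure.map (fun z : E3 => z - p) μ ∈ C i)
    (hpiece : ∀ i, (∀ᵐ μ ∂P, ∀ p : E3, μ {p} ≠ 0 → Measure.map (fun z : E3 => z - p) μ ∈ C i) → Nonempty (LawLedger P c)) :
    Nonempty (LawLedger P c) := by
  obtain ⟨i, hi⟩ := exists_ae_forall_reroot_of_ergodic_cover hδ hcore C hC herg hcover
  exact hpiece i hi

end Summit.AtomisticToContinuum.Crystallization.Theorems.FrustratedLawDichotomySignedLedgerSaturated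

end
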